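import Mathlib.Analysis.Complex.Polynomial.Basic
import Mathlib.Analysis.Matrix.Spectrum
import Mathlib.LinearAlgebra.FiniteDimensional.Lemmas
import Mathlib.Tactic.NoncommRing
import HarnessLib

/-!
# Representations of Clifford (anticommutation) relations have dimension divisible by `2^ℓ`

Source. A. Prakash, J. Sikora, A. Varvitsiotis, Z. Wei, *Completely positive semidefinite rank*,
Math. Program. 171 (2018) 397–431 = arXiv:1604.07199 [PrakashEtAl2017], §7 "Clifford algebras",
Theorem 19 (p23, after Goodman–Wallach [GW]: "Let `β` be a nondegenerate bilinear form on `V`.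
(i) If `dim V = 2ℓ` then (up to isomorphism) there exists a unique irreducible representation of
`Cl(V, β)` which has dimension `2^ℓ`; (ii) If `dim V = 2ℓ+1` then there exist two nonisomorphic
irreducible representations of `Cl(V, β)`. Both representations have dimension `2^ℓ`"), and its use
in the proof of Theorem 11 (§8, p24): operators with `{f(λ), f(μ)} = β(λ, μ)·I` for a nondegenerate
symmetric `β` on `ℝ^τ` "can be extended to a representation of the Clifford algebra `Cl(ℝ^τ, β)` …
Any representation of `Cl(ℝ^τ, β)` can be decomposed as a direct sum of irreducible ones, which by
Theorem 19 have size at least `2^{⌊τ/2⌋}`. This implies that `d² ≥ 2^{⌊τ/2⌋}`".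

What is PROVED here is the dimension statement that proof needs, for complex representations, by
an elementary induction instead of the structure theory of Clifford algebras:

* `two_pow_dvd_finrank_of_anticommute`: a finite-dimensional complex vector space carrying `2ℓ`
  pairwise anticommuting operators with nonzero scalar squares has dimension divisible by `2^ℓ`
  (split `W` into the `±μ`-eigenspaces of `E_a E_b`, exchanged by `E_a`, preserved by the rest);
* `two_pow_dvd_of_anticommutator_eq_gram`: PSVW's form — matrices `A_x ∈ M_D(ℂ)`, `x < τ`, with
  `A_x A_{x'} + A_{x'} A_x = 2 G_{xx'} I` for a real symmetric `G` with `det G ≠ 0` force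
  `2^{⌊τ/2⌋} ∣ D` (diagonalise `G` by the spectral theorem and pass to `E_i = Σ_x u_i(x) A_x`);
* `sqrt_two_pow_le_of_two_pow_dvd_sq`: the numerical form `√2^m ≤ d` of `2^m ∣ d²` used on p24.
* `two_pow_mul_dvd_finrank_of_anticommute_of_commute`,
  `two_pow_mul_two_pow_dvd_finrank_of_anticommute_of_commute`,
  `two_pow_mul_two_pow_dvd_of_anticommutator_eq_gram_of_commute` (appended): the TWO-SIDED form
  used by Gribling–de Laat–Laurent [GriblingDelaatLaurent2017, Thm. 4.4]: two families of Clifford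
  generators (`2ℓ` and `2ℓ'` of them) that commute with each other force `2^ℓ · 2^{ℓ'} ∣ dim` — the
  dimension count of "irreducible representations of `𝒞(r) ⊗ 𝒞(r)` have size at least
  `(2^{⌊r/2⌋})²`", proved by carrying the commuting family through the same induction.

This is the Clifford-algebra half of PSVW Theorem 11 (`PrakashEtAl2017_thm11` in
`Literature/Combinatorics/Optimization/CompletelyPsdRank.lean`); the other half is Tsirelson's
rigidity theorem (PSVW Lemma 12 / Theorem 20 = [TS87]), not in the tree. The companion EXISTENCE
statement (Clifford representations of size `2^{⌈n/2⌉}`, Brauer–Weyl matrices) is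
`Literature.Combinatorics.Optimization.exists_lorentz_isometry`. NOT here: uniqueness /
irreducibility in Theorem 19, real Clifford modules.
-/

noncomputable section

namespace Literature.LinearAlgebra

open Module Matrix

/-- **Clifford relations force the dimension to be a multiple of `2^ℓ`.** Let `W` be a
finite-dimensional complex vector space carrying `2ℓ` linear operators `E_i` with `E_i² = c_i · 1`,
`c_i ≠ 0`, and `E_i E_j = −E_j E_i` (`i ≠ j`). Then `2^ℓ ∣ dim W`. (Induction on `ℓ`: `P = E_a E_b`
has `P² = −c_a c_b ≠ 0`, so `W = V₊ ⊕ V₋` splits into the `±μ`-eigenspaces of `P` (`μ² = −c_a c_b`),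
`E_a` exchanges them injectively, so `dim W = 2 dim V₊`, and the remaining `2ℓ − 2` operators commute
with `P` and restrict to `V₊`.) This is the dimension statement of the classification of Clifford
modules (PSVW Theorem 19, after Goodman–Wallach: irreducible representations of `Cl(V, β)`,
`dim V ∈ {2ℓ, 2ℓ+1}`, `β` nondegenerate, have dimension `2^ℓ`), in the form used in PSVW's proof of
Theorem 11 ("any representation … has size at least `2^{⌊τ/2⌋}`").
[cite: PrakashEtAl2017, Thm. 19 (p23) and proof of Thm. 11 (p24)] -/
theorem two_pow_dvd_finrank_of_anticommute (ℓ : ℕ) {W : Type*} [AddCommGroup W] [Module ℂ W]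
    [FiniteDimensional ℂ W] (E : Fin (2 * ℓ) → Module.End ℂ W) (c : Fin (2 * ℓ) → ℂ)
    (hc : ∀ i, c i ≠ 0) (hsq : ∀ i, E i * E i = c i • (1 : Module.End ℂ W))
    (hanti : ∀ i j, i ≠ j → E i * E j = -(E j * E i)) : 2 ^ ℓ ∣ finrank ℂ W := by
  induction ℓ generalizing W with
  | zero => simp
  | succ ℓ ih =>
    -- two distinguished generators `E_a, E_b` and `P = E_a E_b`
    let a : Fin (2 * (ℓ + 1)) := ⟨2 * ℓ, by omega⟩
    let b : Fin (2 * (ℓ + 1)) := ⟨2 * ℓ + 1, by omega⟩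
    have hab : a ≠ b := by simp [a, b, Fin.ext_iff]
    obtain ⟨P, hP⟩ : ∃ P : Module.End ℂ W, P = E a * E b := ⟨_, rfl⟩
    have hsmul1 : ∀ s t : ℂ, (s • (1 : Module.End ℂ W)) * (t • (1 : Module.End ℂ W)) =
        (s * t) • (1 : Module.End ℂ W) := fun s t => by
      rw [smul_mul_assoc, one_mul, smul_smul]
    have hP2 : P * P = (-(c a * c b)) • (1 : Module.End ℂ W) := by
      calc P * P = E a * (E b * E a) * E b := by rw [hP]; noncomm_ring
        _ = E a * (-(E a * E b)) * E b := by rw [hanti b a hab.symm]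
        _ = -((E a * E a) * (E b * E b)) := by noncomm_ring
        _ = _ := by rw [hsq a, hsq b, hsmul1, neg_smul]
    obtain ⟨μ, hμ⟩ := IsAlgClosed.exists_eq_mul_self (-(c a * c b))
    have hμ0 : μ ≠ 0 := by
      rintro rfl
      rw [mul_zero, neg_eq_zero] at hμ
      exact mul_ne_zero (hc a) (hc b) hμ
    have hPPv : ∀ v, P (P v) = μ • μ • v := fun v => by
      have := congrArg (fun f : Module.End ℂ W => f v) hP2
      simpa only [Module.End.mul_apply, LinearMap.smul_apply, Module.End.one_apply, hμ,
        smul_smul] using this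
    -- `E_a` anticommutes with `P`; the other generators commute with `P`
    have h1 : E a * P = c a • E b := by
      rw [hP, ← mul_assoc, hsq a, smul_mul_assoc, one_mul]
    have h2 : P * E a = -(c a • E b) := by
      rw [hP, mul_assoc, hanti b a hab.symm, mul_neg, ← mul_assoc, hsq a, smul_mul_assoc, one_mul]
    have hPa : P * E a = -(E a * P) := by rw [h1, h2]
    have hcomm : ∀ i, i ≠ a → i ≠ b → E i * P = P * E i := fun i hia hib => by
      rw [hP, ← mul_assoc, hanti i a hia, neg_mul, mul_assoc, hanti i b hib, mul_neg, neg_neg,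
        mul_assoc]
    -- the `±μ` eigenspaces of `P`
    let Vp : Submodule ℂ W := LinearMap.ker (P - μ • 1)
    let Vm : Submodule ℂ W := LinearMap.ker (P + μ • 1)
    have memVp : ∀ v, v ∈ Vp ↔ P v = μ • v := fun v => by
      simp only [Vp, LinearMap.mem_ker, LinearMap.sub_apply, LinearMap.smul_apply,
        Module.End.one_apply, sub_eq_zero]
    have memVm : ∀ v, v ∈ Vm ↔ P v = -(μ • v) := fun v => by
      simp only [Vm, LinearMap.mem_ker, LinearMap.add_apply, LinearMap.smul_apply,
        Module.End.one_apply, add_eq_zero_iff_eq_neg]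
    have hinf : Vp ⊓ Vm = ⊥ := by
      rw [eq_bot_iff]
      intro v hv
      rw [Submodule.mem_inf, memVp, memVm] at hv
      have h3 : μ • v = -(μ • v) := hv.1.symm.trans hv.2
      have h4 : (2 * μ) • v = 0 := by
        rw [mul_smul, two_smul]
        nth_rw 1 [h3]
        exact neg_add_cancel (μ • v)
      rw [Submodule.mem_bot]
      exact (smul_eq_zero.mp h4).resolve_left (mul_ne_zero two_ne_zero hμ0)
    have hsup : Vp ⊔ Vm = ⊤ := by
      rw [eq_top_iff]
      rintro v -
      rw [Submodule.mem_sup]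
      refine ⟨(2 : ℂ)⁻¹ • (v + μ⁻¹ • P v), ?_, (2 : ℂ)⁻¹ • (v - μ⁻¹ • P v), ?_, ?_⟩
      · rw [memVp, map_smul, map_add, map_smul, hPPv, smul_smul μ⁻¹ μ, inv_mul_cancel₀ hμ0,
          one_smul, smul_comm μ (2 : ℂ)⁻¹, smul_add μ, smul_smul μ μ⁻¹, mul_inv_cancel₀ hμ0,
          one_smul, add_comm (P v)]
      · rw [memVm, map_smul, map_sub, map_smul, hPPv, smul_smul μ⁻¹ μ, inv_mul_cancel₀ hμ0,
          one_smul, smul_comm μ (2 : ℂ)⁻¹, ← smul_neg, smul_sub μ, smul_smul μ μ⁻¹,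
          mul_inv_cancel₀ hμ0, one_smul, neg_sub]
      · rw [← smul_add, add_add_sub_cancel, ← two_smul ℂ v, smul_smul, inv_mul_cancel₀ two_ne_zero,
          one_smul]
    -- `E_a` exchanges the eigenspaces injectively
    have haVp : ∀ v ∈ Vp, E a v ∈ Vm := fun v hv => by
      rw [memVp] at hv
      rw [memVm, ← Module.End.mul_apply, hPa, LinearMap.neg_apply, Module.End.mul_apply, hv,
        map_smul]
    have haVm : ∀ v ∈ Vm, E a v ∈ Vp := fun v hv => by
      rw [memVm] at hv
      rw [memVp, ← Module.End.mul_apply, hPa, LinearMap.neg_apply, Module.End.mul_apply, hv,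
        map_neg, map_smul, neg_neg]
    have hainj : Function.Injective (E a) := by
      intro v w hvw
      have := congrArg (E a) hvw
      rw [← Module.End.mul_apply, ← Module.End.mul_apply, hsq a, LinearMap.smul_apply,
        LinearMap.smul_apply, Module.End.one_apply, Module.End.one_apply] at this
      exact smul_right_injective W (hc a) this
    have hle1 : finrank ℂ Vp ≤ finrank ℂ Vm :=
      LinearMap.finrank_le_finrank_of_injective (f := (E a).restrict haVp) fun v w h =>
        Subtype.ext (hainj (by simpa [LinearMap.restrict_apply] using congrArg Subtype.val h))
    have hle2 : finrank ℂ Vm ≤ finrank ℂ Vp :=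
      LinearMap.finrank_le_finrank_of_injective (f := (E a).restrict haVm) fun v w h =>
        Subtype.ext (hainj (by simpa [LinearMap.restrict_apply] using congrArg Subtype.val h))
    -- the remaining generators restrict to `V₊`
    let ι' : Fin (2 * ℓ) → Fin (2 * (ℓ + 1)) := Fin.castLE (by omega)
    have hcast : ∀ k, ι' k ≠ a ∧ ι' k ≠ b := fun k => by
      constructor <;> simp [ι', a, b, Fin.ext_iff] <;> omega
    have hmapk : ∀ k, ∀ v ∈ Vp, E (ι' k) v ∈ Vp := fun k v hv => by
      rw [memVp] at hv ⊢
      rw [← Module.End.mul_apply, ← hcomm _ (hcast k).1 (hcast k).2, Module.End.mul_apply, hv,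
        map_smul]
    let E' : Fin (2 * ℓ) → Module.End ℂ Vp := fun k => (E (ι' k)).restrict (hmapk k)
    have hsq' : ∀ k, E' k * E' k = c (ι' k) • (1 : Module.End ℂ Vp) := fun k => by
      apply LinearMap.ext
      intro v
      apply Subtype.ext
      simp only [E', Module.End.mul_apply, LinearMap.coe_restrict_apply, LinearMap.smul_apply,
        Module.End.one_apply, Submodule.coe_smul]
      rw [← Module.End.mul_apply, hsq, LinearMap.smul_apply, Module.End.one_apply]
    have hanti' : ∀ k k', k ≠ k' → E' k * E' k' = -(E' k' * E' k) := fun k k' hkk => by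
      have hne : ι' k ≠ ι' k' := fun h => hkk (Fin.castLE_injective _ h)
      apply LinearMap.ext
      intro v
      apply Subtype.ext
      simp only [E', Module.End.mul_apply, LinearMap.coe_restrict_apply, LinearMap.neg_apply,
        Submodule.coe_neg]
      rw [← Module.End.mul_apply, hanti _ _ hne, LinearMap.neg_apply, Module.End.mul_apply]
    have hdvd := ih E' (fun k => c (ι' k)) (fun k => hc _) hsq' hanti'
    -- dimension count
    have hsum := Submodule.finrank_sup_add_finrank_inf_eq Vp Vm
    rw [hsup, hinf, finrank_top, finrank_bot, add_zero, le_antisymm hle2 hle1] at hsum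
    obtain ⟨m, hm⟩ := hdvd
    exact ⟨m, by rw [hsum, hm]; ring⟩

/-- Linear combinations of a family multiply termwise:
`(Σ_x u_x A_x)(Σ_{x'} v_{x'} A_{x'}) = Σ_x Σ_{x'} u_x v_{x'} A_x A_{x'}`. [folklore] -/
private theorem sum_smul_mul_sum_smul_matrix {τ D : ℕ} (u v : Fin τ → ℂ)
    (A : Fin τ → Matrix (Fin D) (Fin D) ℂ) :
    (∑ x, u x • A x) * (∑ x', v x' • A x') = ∑ x, ∑ x', (u x * v x') • (A x * A x') := by
  rw [Finset.sum_mul]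
  refine Finset.sum_congr rfl fun x _ => ?_
  rw [Finset.mul_sum]
  refine Finset.sum_congr rfl fun x' _ => ?_
  rw [smul_mul_assoc, mul_smul_comm, smul_smul]

/-- **The dimension bound in PSVW's form** (proof of Theorem 11, p24: operators `A_x = f(u_x)` with
`{A_x, A_{x'}} = 2⟨u_x, u_{x'}⟩ I`, `β = 2·Gram` nondegenerate, "can be extended to a representation of
the Clifford algebra `Cl(ℝ^τ, β)` … which by Theorem 19 ha[s] size at least `2^{⌊τ/2⌋}`"). Typed over
matrices: if `A_x ∈ M_D(ℂ)` (`x < τ`) satisfy `A_x A_{x'} + A_{x'} A_x = 2 G_{xx'} · I` for a real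
symmetric matrix `G` with `det G ≠ 0`, then `2^{⌊τ/2⌋} ∣ D` (diagonalise `G = Σ λ_i u_i u_iᵀ` by the
spectral theorem; the operators `E_i = Σ_x u_i(x) A_x` satisfy `E_i² = λ_i I`, `λ_i ≠ 0`, and
anticommute, and `two_pow_dvd_finrank_of_anticommute` applies to `2⌊τ/2⌋` of them).
[cite: PrakashEtAl2017, Thm. 19 (p23) and proof of Thm. 11 (p24)] -/
theorem two_pow_dvd_of_anticommutator_eq_gram {τ D : ℕ} (A : Fin τ → Matrix (Fin D) (Fin D) ℂ)
    (G : Matrix (Fin τ) (Fin τ) ℝ) (hG : G.IsSymm) (hGdet : G.det ≠ 0)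
    (hA : ∀ x x', A x * A x' + A x' * A x = ((2 * G x x' : ℝ) : ℂ) • (1 : Matrix (Fin D) (Fin D) ℂ)) :
    2 ^ (τ / 2) ∣ D := by
  classical
  have hGH : G.IsHermitian := by
    unfold Matrix.IsHermitian
    rw [Matrix.conjTranspose_eq_transpose_of_trivial]
    exact hG
  -- an orthonormal eigenbasis `u_i` of `G`, eigenvalues `λ_i ≠ 0`
  set lam : Fin τ → ℝ := hGH.eigenvalues with hlam
  set u : Fin τ → Fin τ → ℝ := fun i => WithLp.ofLp (hGH.eigenvectorBasis i) with hu
  have hGu : ∀ i, G *ᵥ u i = lam i • u i := fun i => hGH.mulVec_eigenvectorBasis i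
  have huu : ∀ i j, u i ⬝ᵥ u j = if i = j then 1 else 0 := fun i j => by
    have h := hGH.eigenvectorBasis.inner_eq_ite j i
    rw [EuclideanSpace.inner_eq_star_dotProduct, star_trivial] at h
    rw [hu, h]
    simp only [eq_comm]
  have hlam0 : ∀ i, lam i ≠ 0 := by
    intro i hi
    apply hGdet
    rw [hGH.det_eq_prod_eigenvalues]
    exact Finset.prod_eq_zero (Finset.mem_univ i) (by rw [← hlam, hi]; rfl)
  have hscal : ∀ i j, ∑ x, ∑ x', u i x * G x x' * u j x' = if i = j then lam i else 0 := by
    intro i j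
    have : ∑ x, ∑ x', u i x * G x x' * u j x' = u i ⬝ᵥ (G *ᵥ u j) := by
      simp only [dotProduct, Matrix.mulVec, Finset.mul_sum, mul_assoc]
    rw [this, hGu, dotProduct_smul, smul_eq_mul, huu]
    split_ifs with h
    · rw [h, mul_one]
    · rw [mul_zero]
  -- the operators `E_i = Σ_x u_i(x) A_x`
  set E : Fin τ → Matrix (Fin D) (Fin D) ℂ := fun i => ∑ x, ((u i x : ℝ) : ℂ) • A x with hE
  have hEE : ∀ i j, E i * E j + E j * E i =
      ((2 * (if i = j then lam i else 0) : ℝ) : ℂ) • (1 : Matrix (Fin D) (Fin D) ℂ) := by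
    intro i j
    have h1 : E i * E j = ∑ x, ∑ x', (((u i x : ℝ) : ℂ) * ((u j x' : ℝ) : ℂ)) • (A x * A x') :=
      sum_smul_mul_sum_smul_matrix _ _ A
    have h2 : E j * E i = ∑ x, ∑ x', (((u i x : ℝ) : ℂ) * ((u j x' : ℝ) : ℂ)) • (A x' * A x) := by
      rw [hE, sum_smul_mul_sum_smul_matrix, Finset.sum_comm]
      refine Finset.sum_congr rfl fun x _ => Finset.sum_congr rfl fun x' _ => ?_
      rw [mul_comm]
    rw [h1, h2, ← Finset.sum_add_distrib]
    simp_rw [← Finset.sum_add_distrib, ← smul_add, hA, smul_smul, ← Finset.sum_smul]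
    congr 1
    rw [← hscal i j]
    push_cast
    rw [Finset.mul_sum]
    refine Finset.sum_congr rfl fun x _ => ?_
    rw [Finset.mul_sum]
    refine Finset.sum_congr rfl fun x' _ => ?_
    ring
  have hsqE : ∀ i, E i * E i = ((lam i : ℝ) : ℂ) • (1 : Matrix (Fin D) (Fin D) ℂ) := by
    intro i
    have h := hEE i i
    rw [if_pos rfl, ← two_smul ℂ (E i * E i)] at h
    refine smul_right_injective (Matrix (Fin D) (Fin D) ℂ) (two_ne_zero (α := ℂ)) ?_
    show (2 : ℂ) • (E i * E i) = (2 : ℂ) • (((lam i : ℝ) : ℂ) • (1 : Matrix (Fin D) (Fin D) ℂ))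
    rw [h, smul_smul]
    push_cast
    ring_nf
  have hantiE : ∀ i j, i ≠ j → E i * E j = -(E j * E i) := by
    intro i j hij
    have h := hEE i j
    rw [if_neg hij, mul_zero] at h
    simp only [Complex.ofReal_zero, zero_smul] at h
    exact eq_neg_of_add_eq_zero_left h
  -- transfer to `Module.End ℂ (Fin D → ℂ)` and apply the abstract statement to `2⌊τ/2⌋` generators
  let φ := Matrix.toLinAlgEquiv' (R := ℂ) (n := Fin D)
  let ι : Fin (2 * (τ / 2)) → Fin τ := Fin.castLE (Nat.mul_div_le τ 2)
  have hι : Function.Injective ι := Fin.castLE_injective _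
  have key := two_pow_dvd_finrank_of_anticommute (τ / 2) (W := Fin D → ℂ)
    (fun k => φ (E (ι k))) (fun k => ((lam (ι k) : ℝ) : ℂ)) (fun k => by exact_mod_cast hlam0 _)
    (fun k => by rw [← map_mul, hsqE, map_smul, map_one])
    (fun k k' hkk => by rw [← map_mul, hantiE _ _ (fun h => hkk (hι h)), map_neg, map_mul])
  simpa using key

/-- The numerical form used on p24: "`d² ≥ 2^{⌊τ/2⌋}` and thus `d ≥ √2^{⌊τ/2⌋}`" — if `2^m ∣ d²` and
`d ≥ 1` then `√2^m ≤ d`. [cite: PrakashEtAl2017, proof of Thm. 11 (p24)] -/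
theorem sqrt_two_pow_le_of_two_pow_dvd_sq {m d : ℕ} (hd : 0 < d) (h : 2 ^ m ∣ d ^ 2) :
    Real.sqrt 2 ^ m ≤ (d : ℝ) := by
  have hle : (2 : ℝ) ^ m ≤ (d : ℝ) ^ 2 := by
    exact_mod_cast Nat.le_of_dvd (pow_pos hd 2) h
  have h1 : Real.sqrt 2 ^ m = Real.sqrt ((2 : ℝ) ^ m) := by
    rw [Real.sqrt_eq_rpow, Real.sqrt_eq_rpow, ← Real.rpow_natCast, ← Real.rpow_natCast,
      ← Real.rpow_mul (by norm_num), ← Real.rpow_mul (by positivity), mul_comm]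
  rw [h1]
  calc Real.sqrt ((2 : ℝ) ^ m) ≤ Real.sqrt ((d : ℝ) ^ 2) := Real.sqrt_le_sqrt hle
    _ = d := Real.sqrt_sq (by positivity)

/-- **Multiplicity form of the Clifford dimension bound.** Let `W` carry `2ℓ` pairwise anticommuting
operators `E_i` with nonzero scalar squares, and let `S` be a set of operators commuting with every
`E_i`. If every `S`-invariant subspace has dimension divisible by `m`, then `2^ℓ · m ∣ dim W`. (The
induction of `two_pow_dvd_finrank_of_anticommute`, carrying `S` along: `P = E_a E_b` commutes with
`S`, so `S` preserves the eigenspace `V₊` and restricts to it together with the remaining `E_i`.) This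
is the dimension count behind "each irreducible representation of `𝒞(r) ⊗ 𝒞(r)` is the tensor product
of two irreducible representations of `𝒞(r)`" in the proof of GdLL Theorem 4.4.
[cite: GriblingDelaatLaurent2017, proof of Thm. 4.4 (p14–p15)] -/
theorem two_pow_mul_dvd_finrank_of_anticommute_of_commute (ℓ : ℕ) {W : Type*} [AddCommGroup W]
    [Module ℂ W] [FiniteDimensional ℂ W] (E : Fin (2 * ℓ) → Module.End ℂ W) (c : Fin (2 * ℓ) → ℂ)
    (hc : ∀ i, c i ≠ 0) (hsq : ∀ i, E i * E i = c i • (1 : Module.End ℂ W))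
    (hanti : ∀ i j, i ≠ j → E i * E j = -(E j * E i))
    (S : Set (Module.End ℂ W)) (hS : ∀ i, ∀ f ∈ S, E i * f = f * E i) (m : ℕ)
    (hm : ∀ V : Submodule ℂ W, (∀ f ∈ S, ∀ v ∈ V, f v ∈ V) → m ∣ finrank ℂ V) :
    2 ^ ℓ * m ∣ finrank ℂ W := by
  induction ℓ generalizing W with
  | zero =>
    have h := hm ⊤ (fun f _ v _ => Submodule.mem_top)
    rw [finrank_top] at h
    simpa using h
  | succ ℓ ih =>
    -- two distinguished generators `E_a, E_b` and `P = E_a E_b`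
    let a : Fin (2 * (ℓ + 1)) := ⟨2 * ℓ, by omega⟩
    let b : Fin (2 * (ℓ + 1)) := ⟨2 * ℓ + 1, by omega⟩
    have hab : a ≠ b := by simp [a, b, Fin.ext_iff]
    obtain ⟨P, hP⟩ : ∃ P : Module.End ℂ W, P = E a * E b := ⟨_, rfl⟩
    have hsmul1 : ∀ s t : ℂ, (s • (1 : Module.End ℂ W)) * (t • (1 : Module.End ℂ W)) =
        (s * t) • (1 : Module.End ℂ W) := fun s t => by
      rw [smul_mul_assoc, one_mul, smul_smul]
    have hP2 : P * P = (-(c a * c b)) • (1 : Module.End ℂ W) := by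
      calc P * P = E a * (E b * E a) * E b := by rw [hP]; noncomm_ring
        _ = E a * (-(E a * E b)) * E b := by rw [hanti b a hab.symm]
        _ = -((E a * E a) * (E b * E b)) := by noncomm_ring
        _ = _ := by rw [hsq a, hsq b, hsmul1, neg_smul]
    obtain ⟨μ, hμ⟩ := IsAlgClosed.exists_eq_mul_self (-(c a * c b))
    have hμ0 : μ ≠ 0 := by
      rintro rfl
      rw [mul_zero, neg_eq_zero] at hμ
      exact mul_ne_zero (hc a) (hc b) hμ
    have hPPv : ∀ v, P (P v) = μ • μ • v := fun v => by
      have := congrArg (fun f : Module.End ℂ W => f v) hP2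
      simpa only [Module.End.mul_apply, LinearMap.smul_apply, Module.End.one_apply, hμ,
        smul_smul] using this
    -- `E_a` anticommutes with `P`; the other generators and `S` commute with `P`
    have h1 : E a * P = c a • E b := by
      rw [hP, ← mul_assoc, hsq a, smul_mul_assoc, one_mul]
    have h2 : P * E a = -(c a • E b) := by
      rw [hP, mul_assoc, hanti b a hab.symm, mul_neg, ← mul_assoc, hsq a, smul_mul_assoc, one_mul]
    have hPa : P * E a = -(E a * P) := by rw [h1, h2]
    have hcomm : ∀ i, i ≠ a → i ≠ b → E i * P = P * E i := fun i hia hib => by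
      rw [hP, ← mul_assoc, hanti i a hia, neg_mul, mul_assoc, hanti i b hib, mul_neg, neg_neg,
        mul_assoc]
    have hcommS : ∀ f ∈ S, f * P = P * f := fun f hf => by
      rw [hP, ← mul_assoc, ← hS a f hf, mul_assoc, ← hS b f hf, mul_assoc]
    -- the `±μ` eigenspaces of `P`
    let Vp : Submodule ℂ W := LinearMap.ker (P - μ • 1)
    let Vm : Submodule ℂ W := LinearMap.ker (P + μ • 1)
    have memVp : ∀ v, v ∈ Vp ↔ P v = μ • v := fun v => by
      simp only [Vp, LinearMap.mem_ker, LinearMap.sub_apply, LinearMap.smul_apply,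
        Module.End.one_apply, sub_eq_zero]
    have memVm : ∀ v, v ∈ Vm ↔ P v = -(μ • v) := fun v => by
      simp only [Vm, LinearMap.mem_ker, LinearMap.add_apply, LinearMap.smul_apply,
        Module.End.one_apply, add_eq_zero_iff_eq_neg]
    have hinf : Vp ⊓ Vm = ⊥ := by
      rw [eq_bot_iff]
      intro v hv
      rw [Submodule.mem_inf, memVp, memVm] at hv
      have h3 : μ • v = -(μ • v) := hv.1.symm.trans hv.2
      have h4 : (2 * μ) • v = 0 := by
        rw [mul_smul, two_smul]
        nth_rw 1 [h3]
        exact neg_add_cancel (μ • v)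
      rw [Submodule.mem_bot]
      exact (smul_eq_zero.mp h4).resolve_left (mul_ne_zero two_ne_zero hμ0)
    have hsup : Vp ⊔ Vm = ⊤ := by
      rw [eq_top_iff]
      rintro v -
      rw [Submodule.mem_sup]
      refine ⟨(2 : ℂ)⁻¹ • (v + μ⁻¹ • P v), ?_, (2 : ℂ)⁻¹ • (v - μ⁻¹ • P v), ?_, ?_⟩
      · rw [memVp, map_smul, map_add, map_smul, hPPv, smul_smul μ⁻¹ μ, inv_mul_cancel₀ hμ0,
          one_smul, smul_comm μ (2 : ℂ)⁻¹, smul_add μ, smul_smul μ μ⁻¹, mul_inv_cancel₀ hμ0,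
          one_smul, add_comm (P v)]
      · rw [memVm, map_smul, map_sub, map_smul, hPPv, smul_smul μ⁻¹ μ, inv_mul_cancel₀ hμ0,
          one_smul, smul_comm μ (2 : ℂ)⁻¹, ← smul_neg, smul_sub μ, smul_smul μ μ⁻¹,
          mul_inv_cancel₀ hμ0, one_smul, neg_sub]
      · rw [← smul_add, add_add_sub_cancel, ← two_smul ℂ v, smul_smul, inv_mul_cancel₀ two_ne_zero,
          one_smul]
    -- `E_a` exchanges the eigenspaces injectively
    have haVp : ∀ v ∈ Vp, E a v ∈ Vm := fun v hv => by
      rw [memVp] at hv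
      rw [memVm, ← Module.End.mul_apply, hPa, LinearMap.neg_apply, Module.End.mul_apply, hv,
        map_smul]
    have haVm : ∀ v ∈ Vm, E a v ∈ Vp := fun v hv => by
      rw [memVm] at hv
      rw [memVp, ← Module.End.mul_apply, hPa, LinearMap.neg_apply, Module.End.mul_apply, hv,
        map_neg, map_smul, neg_neg]
    have hainj : Function.Injective (E a) := by
      intro v w hvw
      have := congrArg (E a) hvw
      rw [← Module.End.mul_apply, ← Module.End.mul_apply, hsq a, LinearMap.smul_apply,
        LinearMap.smul_apply, Module.End.one_apply, Module.End.one_apply] at this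
      exact smul_right_injective W (hc a) this
    have hle1 : finrank ℂ Vp ≤ finrank ℂ Vm :=
      LinearMap.finrank_le_finrank_of_injective (f := (E a).restrict haVp) fun v w h =>
        Subtype.ext (hainj (by simpa [LinearMap.restrict_apply] using congrArg Subtype.val h))
    have hle2 : finrank ℂ Vm ≤ finrank ℂ Vp :=
      LinearMap.finrank_le_finrank_of_injective (f := (E a).restrict haVm) fun v w h =>
        Subtype.ext (hainj (by simpa [LinearMap.restrict_apply] using congrArg Subtype.val h))
    -- the remaining generators restrict to `V₊`
    let ι' : Fin (2 * ℓ) → Fin (2 * (ℓ + 1)) := Fin.castLE (by omega)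
    have hcast : ∀ k, ι' k ≠ a ∧ ι' k ≠ b := fun k => by
      constructor <;> simp [ι', a, b, Fin.ext_iff] <;> omega
    have hmapk : ∀ k, ∀ v ∈ Vp, E (ι' k) v ∈ Vp := fun k v hv => by
      rw [memVp] at hv ⊢
      rw [← Module.End.mul_apply, ← hcomm _ (hcast k).1 (hcast k).2, Module.End.mul_apply, hv,
        map_smul]
    let E' : Fin (2 * ℓ) → Module.End ℂ Vp := fun k => (E (ι' k)).restrict (hmapk k)
    have hsq' : ∀ k, E' k * E' k = c (ι' k) • (1 : Module.End ℂ Vp) := fun k => by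
      apply LinearMap.ext
      intro v
      apply Subtype.ext
      simp only [E', Module.End.mul_apply, LinearMap.coe_restrict_apply, LinearMap.smul_apply,
        Module.End.one_apply, Submodule.coe_smul]
      rw [← Module.End.mul_apply, hsq, LinearMap.smul_apply, Module.End.one_apply]
    have hanti' : ∀ k k', k ≠ k' → E' k * E' k' = -(E' k' * E' k) := fun k k' hkk => by
      have hne : ι' k ≠ ι' k' := fun h => hkk (Fin.castLE_injective _ h)
      apply LinearMap.ext
      intro v
      apply Subtype.ext
      simp only [E', Module.End.mul_apply, LinearMap.coe_restrict_apply, LinearMap.neg_apply,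
        Submodule.coe_neg]
      rw [← Module.End.mul_apply, hanti _ _ hne, LinearMap.neg_apply, Module.End.mul_apply]
    -- `S` restricts to `V₊`
    have hmapS : ∀ f ∈ S, ∀ v ∈ Vp, f v ∈ Vp := fun f hf v hv => by
      rw [memVp] at hv ⊢
      rw [← Module.End.mul_apply, ← hcommS f hf, Module.End.mul_apply, hv, map_smul]
    let S' : Set (Module.End ℂ Vp) := {g | ∃ (f : Module.End ℂ W) (hf : f ∈ S), g = f.restrict (hmapS f hf)}
    have hS' : ∀ k, ∀ g ∈ S', E' k * g = g * E' k := by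
      rintro k g ⟨f, hf, rfl⟩
      apply LinearMap.ext
      intro v
      apply Subtype.ext
      simp only [E', Module.End.mul_apply, LinearMap.coe_restrict_apply]
      rw [← Module.End.mul_apply, hS _ f hf, Module.End.mul_apply]
    have hm' : ∀ V' : Submodule ℂ Vp, (∀ g ∈ S', ∀ v ∈ V', g v ∈ V') → m ∣ finrank ℂ V' := by
      intro V' hV'
      have hV : ∀ f ∈ S, ∀ v ∈ V'.map Vp.subtype, f v ∈ V'.map Vp.subtype := by
        rintro f hf v ⟨v', hv', rfl⟩
        refine ⟨(f.restrict (hmapS f hf)) v', hV' _ ⟨f, hf, rfl⟩ v' hv', ?_⟩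
        simp [LinearMap.restrict_apply]
      have h := hm (V'.map Vp.subtype) hV
      rwa [Submodule.finrank_map_subtype_eq] at h
    have hdvd := ih E' (fun k => c (ι' k)) (fun k => hc _) hsq' hanti' S' hS' hm'
    -- dimension count
    have hsum := Submodule.finrank_sup_add_finrank_inf_eq Vp Vm
    rw [hsup, hinf, finrank_top, finrank_bot, add_zero, le_antisymm hle2 hle1] at hsum
    obtain ⟨q, hq⟩ := hdvd
    exact ⟨q, by rw [hsum, hq]; ring⟩

/-- **Two commuting families of Clifford generators force `2^ℓ · 2^{ℓ'} ∣ dim`.** If `W` carries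
`2ℓ` pairwise anticommuting operators `E_i` and `2ℓ'` pairwise anticommuting operators `F_j`, all with
nonzero scalar squares, and every `E_i` commutes with every `F_j`, then `2^ℓ 2^{ℓ'} ∣ dim W` — the
dimension statement of "irreducible representations of the tensor product `𝒞(r) ⊗ 𝒞(r)` must have
size at least `(2^{⌊r/2⌋})²`" (GdLL, proof of Theorem 4.4), by
`two_pow_mul_dvd_finrank_of_anticommute_of_commute` with `S = {F_j}` and
`two_pow_dvd_finrank_of_anticommute` on each `S`-invariant subspace.
[cite: GriblingDelaatLaurent2017, proof of Thm. 4.4 (p14–p15)] -/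
theorem two_pow_mul_two_pow_dvd_finrank_of_anticommute_of_commute (ℓ ℓ' : ℕ) {W : Type*}
    [AddCommGroup W] [Module ℂ W] [FiniteDimensional ℂ W]
    (E : Fin (2 * ℓ) → Module.End ℂ W) (c : Fin (2 * ℓ) → ℂ) (hc : ∀ i, c i ≠ 0)
    (hsq : ∀ i, E i * E i = c i • (1 : Module.End ℂ W))
    (hanti : ∀ i j, i ≠ j → E i * E j = -(E j * E i))
    (F : Fin (2 * ℓ') → Module.End ℂ W) (c' : Fin (2 * ℓ') → ℂ) (hc' : ∀ j, c' j ≠ 0)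
    (hsq' : ∀ j, F j * F j = c' j • (1 : Module.End ℂ W))
    (hanti' : ∀ j j', j ≠ j' → F j * F j' = -(F j' * F j))
    (hEF : ∀ i j, E i * F j = F j * E i) :
    2 ^ ℓ * 2 ^ ℓ' ∣ finrank ℂ W := by
  refine two_pow_mul_dvd_finrank_of_anticommute_of_commute ℓ E c hc hsq hanti (Set.range F)
    (by rintro i f ⟨j, rfl⟩; exact hEF i j) (2 ^ ℓ') fun V hV => ?_
  have hFV : ∀ j, ∀ v ∈ V, F j v ∈ V := fun j v hv => hV (F j) ⟨j, rfl⟩ v hv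
  let F' : Fin (2 * ℓ') → Module.End ℂ V := fun j => (F j).restrict (hFV j)
  refine two_pow_dvd_finrank_of_anticommute ℓ' F' c' hc' (fun j => ?_) (fun j j' hjj => ?_)
  · apply LinearMap.ext
    intro v
    apply Subtype.ext
    simp only [F', Module.End.mul_apply, LinearMap.coe_restrict_apply, LinearMap.smul_apply,
      Module.End.one_apply, Submodule.coe_smul]
    rw [← Module.End.mul_apply, hsq', LinearMap.smul_apply, Module.End.one_apply]
  · apply LinearMap.ext
    intro v
    apply Subtype.ext
    simp only [F', Module.End.mul_apply, LinearMap.coe_restrict_apply, LinearMap.neg_apply,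
      Submodule.coe_neg]
    rw [← Module.End.mul_apply, hanti' _ _ hjj, LinearMap.neg_apply, Module.End.mul_apply]

/-- Linear combinations of two families multiply termwise:
`(Σ_x u_x A_x)(Σ_y v_y B_y) = Σ_x Σ_y u_x v_y A_x B_y`. [folklore] -/
private theorem sum_smul_mul_sum_smul_matrix₂ {τ τ' D : ℕ} (u : Fin τ → ℂ) (v : Fin τ' → ℂ)
    (A : Fin τ → Matrix (Fin D) (Fin D) ℂ) (B : Fin τ' → Matrix (Fin D) (Fin D) ℂ) :
    (∑ x, u x • A x) * (∑ y, v y • B y) = ∑ x, ∑ y, (u x * v y) • (A x * B y) := by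
  rw [Finset.sum_mul]
  refine Finset.sum_congr rfl fun x _ => ?_
  rw [Finset.mul_sum]
  refine Finset.sum_congr rfl fun y _ => ?_
  rw [smul_mul_assoc, mul_smul_comm, smul_smul]

/-- Diagonalising the form: from `A_x A_{x'} + A_{x'} A_x = 2 G_{xx'} I` with `G` real symmetric
nonsingular, the operators `E_i = Σ_x u_i(x) A_x` along an orthonormal eigenbasis `u_i` of `G` satisfy
`E_i² = λ_i I` (`λ_i ≠ 0` the eigenvalues) and anticommute pairwise (the step "can be extended to a
representation of the Clifford algebra" of PSVW p24, as in `two_pow_dvd_of_anticommutator_eq_gram`).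
[cite: PrakashEtAl2017, proof of Thm. 11 (p24)] -/
private theorem exists_clifford_generators_of_anticommutator_eq_gram {τ D : ℕ}
    (A : Fin τ → Matrix (Fin D) (Fin D) ℂ) (G : Matrix (Fin τ) (Fin τ) ℝ) (hG : G.IsSymm)
    (hGdet : G.det ≠ 0)
    (hA : ∀ x x', A x * A x' + A x' * A x = ((2 * G x x' : ℝ) : ℂ) • (1 : Matrix (Fin D) (Fin D) ℂ)) :
    ∃ (u : Fin τ → Fin τ → ℝ) (lam : Fin τ → ℝ), (∀ i, lam i ≠ 0) ∧
      (∀ i, (∑ x, ((u i x : ℝ) : ℂ) • A x) * (∑ x, ((u i x : ℝ) : ℂ) • A x) =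
        ((lam i : ℝ) : ℂ) • (1 : Matrix (Fin D) (Fin D) ℂ)) ∧
      (∀ i j, i ≠ j → (∑ x, ((u i x : ℝ) : ℂ) • A x) * (∑ x, ((u j x : ℝ) : ℂ) • A x) =
        -((∑ x, ((u j x : ℝ) : ℂ) • A x) * (∑ x, ((u i x : ℝ) : ℂ) • A x))) := by
  classical
  have hGH : G.IsHermitian := by
    unfold Matrix.IsHermitian
    rw [Matrix.conjTranspose_eq_transpose_of_trivial]
    exact hG
  set lam : Fin τ → ℝ := hGH.eigenvalues with hlam
  set u : Fin τ → Fin τ → ℝ := fun i => WithLp.ofLp (hGH.eigenvectorBasis i) with hu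
  have hGu : ∀ i, G *ᵥ u i = lam i • u i := fun i => hGH.mulVec_eigenvectorBasis i
  have huu : ∀ i j, u i ⬝ᵥ u j = if i = j then 1 else 0 := fun i j => by
    have h := hGH.eigenvectorBasis.inner_eq_ite j i
    rw [EuclideanSpace.inner_eq_star_dotProduct, star_trivial] at h
    rw [hu, h]
    simp only [eq_comm]
  have hlam0 : ∀ i, lam i ≠ 0 := by
    intro i hi
    apply hGdet
    rw [hGH.det_eq_prod_eigenvalues]
    exact Finset.prod_eq_zero (Finset.mem_univ i) (by rw [← hlam, hi]; rfl)
  have hscal : ∀ i j, ∑ x, ∑ x', u i x * G x x' * u j x' = if i = j then lam i else 0 := by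
    intro i j
    have : ∑ x, ∑ x', u i x * G x x' * u j x' = u i ⬝ᵥ (G *ᵥ u j) := by
      simp only [dotProduct, Matrix.mulVec, Finset.mul_sum, mul_assoc]
    rw [this, hGu, dotProduct_smul, smul_eq_mul, huu]
    split_ifs with h
    · rw [h, mul_one]
    · rw [mul_zero]
  set E : Fin τ → Matrix (Fin D) (Fin D) ℂ := fun i => ∑ x, ((u i x : ℝ) : ℂ) • A x with hE
  have hEE : ∀ i j, E i * E j + E j * E i =
      ((2 * (if i = j then lam i else 0) : ℝ) : ℂ) • (1 : Matrix (Fin D) (Fin D) ℂ) := by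
    intro i j
    have h1 : E i * E j = ∑ x, ∑ x', (((u i x : ℝ) : ℂ) * ((u j x' : ℝ) : ℂ)) • (A x * A x') :=
      sum_smul_mul_sum_smul_matrix₂ _ _ A A
    have h2 : E j * E i = ∑ x, ∑ x', (((u i x : ℝ) : ℂ) * ((u j x' : ℝ) : ℂ)) • (A x' * A x) := by
      rw [hE, sum_smul_mul_sum_smul_matrix₂, Finset.sum_comm]
      refine Finset.sum_congr rfl fun x _ => Finset.sum_congr rfl fun x' _ => ?_
      rw [mul_comm]
    rw [h1, h2, ← Finset.sum_add_distrib]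
    simp_rw [← Finset.sum_add_distrib, ← smul_add, hA, smul_smul, ← Finset.sum_smul]
    congr 1
    rw [← hscal i j]
    push_cast
    rw [Finset.mul_sum]
    refine Finset.sum_congr rfl fun x _ => ?_
    rw [Finset.mul_sum]
    refine Finset.sum_congr rfl fun x' _ => ?_
    ring
  refine ⟨u, lam, hlam0, fun i => ?_, fun i j hij => ?_⟩
  · have h := hEE i i
    rw [if_pos rfl, ← two_smul ℂ (E i * E i)] at h
    refine smul_right_injective (Matrix (Fin D) (Fin D) ℂ) (two_ne_zero (α := ℂ)) ?_
    show (2 : ℂ) • (E i * E i) = (2 : ℂ) • (((lam i : ℝ) : ℂ) • (1 : Matrix (Fin D) (Fin D) ℂ))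
    rw [h, smul_smul]
    push_cast
    ring_nf
  · have h := hEE i j
    rw [if_neg hij, mul_zero] at h
    simp only [Complex.ofReal_zero, zero_smul] at h
    exact eq_neg_of_add_eq_zero_left h

/-- **The two-sided dimension bound in matrix form** (GdLL Theorem 4.4, the Clifford step: commuting
families `A_1,…,A_r` and `B_1,…,B_r` of Clifford generators on `ℂ^d` give a representation of
`𝒞(r) ⊗ 𝒞(r)`, whose irreducible representations have size `≥ (2^{⌊r/2⌋})²`). Typed over matrices
and Gram anticommutators as in `two_pow_dvd_of_anticommutator_eq_gram`: if `A_x ∈ M_D(ℂ)` (`x < τ`)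
and `B_y ∈ M_D(ℂ)` (`y < τ'`) satisfy `{A_x, A_{x'}} = 2G_{xx'} I`, `{B_y, B_{y'}} = 2G'_{yy'} I` for
real symmetric nonsingular `G, G'`, and `A_x B_y = B_y A_x`, then `2^{⌊τ/2⌋} · 2^{⌊τ'/2⌋} ∣ D`.
[cite: GriblingDelaatLaurent2017, Thm. 4.4 and its proof (p14–p15)] -/
theorem two_pow_mul_two_pow_dvd_of_anticommutator_eq_gram_of_commute {τ τ' D : ℕ}
    (A : Fin τ → Matrix (Fin D) (Fin D) ℂ) (B : Fin τ' → Matrix (Fin D) (Fin D) ℂ)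
    (G : Matrix (Fin τ) (Fin τ) ℝ) (hG : G.IsSymm) (hGdet : G.det ≠ 0)
    (G' : Matrix (Fin τ') (Fin τ') ℝ) (hG' : G'.IsSymm) (hG'det : G'.det ≠ 0)
    (hA : ∀ x x', A x * A x' + A x' * A x = ((2 * G x x' : ℝ) : ℂ) • (1 : Matrix (Fin D) (Fin D) ℂ))
    (hB : ∀ y y', B y * B y' + B y' * B y = ((2 * G' y y' : ℝ) : ℂ) • (1 : Matrix (Fin D) (Fin D) ℂ))
    (hAB : ∀ x y, A x * B y = B y * A x) :
    2 ^ (τ / 2) * 2 ^ (τ' / 2) ∣ D := by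
  classical
  obtain ⟨u, lam, hlam0, hsqE, hantiE⟩ :=
    exists_clifford_generators_of_anticommutator_eq_gram A G hG hGdet hA
  obtain ⟨u', lam', hlam0', hsqF, hantiF⟩ :=
    exists_clifford_generators_of_anticommutator_eq_gram B G' hG' hG'det hB
  set E : Fin τ → Matrix (Fin D) (Fin D) ℂ := fun i => ∑ x, ((u i x : ℝ) : ℂ) • A x with hE
  set F : Fin τ' → Matrix (Fin D) (Fin D) ℂ := fun j => ∑ y, ((u' j y : ℝ) : ℂ) • B y with hF
  have hEF : ∀ i j, E i * F j = F j * E i := fun i j => by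
    rw [hE, hF]
    dsimp only
    rw [sum_smul_mul_sum_smul_matrix₂, sum_smul_mul_sum_smul_matrix₂, Finset.sum_comm]
    refine Finset.sum_congr rfl fun x _ => Finset.sum_congr rfl fun y _ => ?_
    rw [hAB, mul_comm]
  -- transfer to `Module.End ℂ (Fin D → ℂ)` and apply the abstract statement
  let φ := Matrix.toLinAlgEquiv' (R := ℂ) (n := Fin D)
  let ι : Fin (2 * (τ / 2)) → Fin τ := Fin.castLE (Nat.mul_div_le τ 2)
  have hι : Function.Injective ι := Fin.castLE_injective _
  let ι₂ : Fin (2 * (τ' / 2)) → Fin τ' := Fin.castLE (Nat.mul_div_le τ' 2)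
  have hι₂ : Function.Injective ι₂ := Fin.castLE_injective _
  have key := two_pow_mul_two_pow_dvd_finrank_of_anticommute_of_commute (τ / 2) (τ' / 2)
    (W := Fin D → ℂ)
    (fun k => φ (E (ι k))) (fun k => ((lam (ι k) : ℝ) : ℂ)) (fun k => by exact_mod_cast hlam0 _)
    (fun k => by rw [← map_mul, hsqE, map_smul, map_one])
    (fun k k' hkk => by rw [← map_mul, hantiE _ _ (fun h => hkk (hι h)), map_neg, map_mul])
    (fun k => φ (F (ι₂ k))) (fun k => ((lam' (ι₂ k) : ℝ) : ℂ)) (fun k => by exact_mod_cast hlam0' _)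
    (fun k => by rw [← map_mul, hsqF, map_smul, map_one])
    (fun k k' hkk => by rw [← map_mul, hantiF _ _ (fun h => hkk (hι₂ h)), map_neg, map_mul])
    (fun i j => by rw [← map_mul, hEF, map_mul])
  simpa using key

end Literature.LinearAlgebra
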